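import Summits.QuantumAdvantage.QuantumAdvantage.Theorems.RankDialI1
import HarnessLib

/-!
# RankDial (I2) — §23 the WIDE-RANK grade `WRankLE` and the SPAN FIBRE / WINDOW THEOREMS (`norm_classSum_le_wrank`, `twelve_mul_win_fibre_le_wrank`, `window_bound_wrank`)

TARGET BY NAME (cell decomp-qadv, RESIDUAL MODE): item stmt-QuantumAdvantage-23109
`Summit.QuantumAdvantage.QuantumAdvantage.Theses.OddPrimeWalk.ManyReadersSqrtOdd`, through rung R5 = `AdviceFreeQNC0.WalkHardFLinSel p`.
This file SUPPORTS the item (`--supports`); it does not close it.  Declaration bodies are byte-identical to the cell node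
«SpanDial» (decomp-qadv lens-1, generation 26, part I; node file RankDialI.lean, whose §1–§21 are node «MixedDial» =
parts G1–G2, H1–H3), cut into ≤ 400-line parts
I1 (§22 indicator closure and the `p^d` composition bound) → I2 (§23 the wide-rank grade `WRankLE`, span fibre and window theorems) → I3 (§24 pieces `WindowSpanLinSel` PROVED `p ≠ 3`, residual `WindowSpreadLinSel`, `span_dial`);
see the node file for the mechanism summary.
-/

set_option linter.dupNamespace false
set_option autoImplicit false

noncomputable section
open Classical

namespace Summit.QuantumAdvantage.QuantumAdvantage.Theorems.RankDial

open Finset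
open Summit.QuantumAdvantage.AdviceFreeQNC0
open Literature.Computability.MetaComplexity Literature.Computability.MetaComplexity.Smolensky

/-! ### §23 The WIDE-RANK grade and the SPAN FIBRE THEOREM -/

/-- **THE WIDE-RANK GRADE** `WRankLE p y lam s r` (g24's `RankLE` restricted to the wide cuts of a linear
representation): there are `d ≤ r` linear forms `Φ₁…Φ_d` of the window such that every cut of window support `> s`
answers, on every outside fibre, through the values `(Φ_k · v)_k`.  [`RankLE p y r ⟹ WRankLE p y lam s r`;
`#wide(s) ≤ r ⟹ WRankLE p y lam s r`; monotone in `r` and in `s`.] -/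
def WRankLE (p : ℕ) [Fact p.Prime] {L ℓ R : ℕ} (y : Fin (L + ℓ + R + 1) → (Fin (L + ℓ + R) → Bool) → Bool)
    (lam : Fin (L + ℓ + R + 1) → Fin (L + ℓ + R) → ZMod p) (s r : ℕ) : Prop :=
  ∃ d : ℕ, d ≤ r ∧ ∃ Φ : Fin d → Fin ℓ → ZMod p,
    ∀ g : Fin (L + ℓ + R + 1), s < (wsupp lam g).card → ∀ (a : Fin L → Bool) (b : Fin R → Bool),
      ∃ T : (Fin d → ZMod p) → Bool, ∀ v : Fin ℓ → Bool,
        y g (glue3 a v b) = T (fun k => ∑ j, if v j then Φ k j else 0)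

section SpanFibre
variable {p : ℕ} [Fact p.Prime] {L ℓ R : ℕ} (c : ℕ) (y : Fin (L + ℓ + R + 1) → (Fin (L + ℓ + R) → Bool) → Bool)
  (lam : Fin (L + ℓ + R + 1) → Fin (L + ℓ + R) → ZMod p) (rr : Fin (L + ℓ + R + 1) → ZMod p)

/-- `WRankLE` is monotone in the rank bound. -/
theorem wRankLE_mono {s r r' : ℕ} (h : WRankLE p y lam s r) (hle : r ≤ r') : WRankLE p y lam s r' := by
  obtain ⟨d, hd, Φ, hΦ⟩ := h
  exact ⟨d, le_trans hd hle, Φ, hΦ⟩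

/-- `WRankLE` is monotone in the width (a larger `s` means fewer wide cuts). -/
theorem wRankLE_mono_width {s s' r : ℕ} (h : WRankLE p y lam s r) (hle : s ≤ s') : WRankLE p y lam s' r := by
  obtain ⟨d, hd, Φ, hΦ⟩ := h
  exact ⟨d, hd, Φ, fun g hg a b => hΦ g (lt_of_le_of_lt hle hg) a b⟩

/-- g24's rank grade implies the wide-rank grade (every width). -/
theorem wRankLE_of_rankLE (s : ℕ) {r : ℕ} (h : RankLE p y r) : WRankLE p y lam s r := by
  obtain ⟨d, hd, Φ, hΦ⟩ := h
  exact ⟨d, hd, Φ, fun g _ a b => hΦ g a b⟩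

/-- **Few wide cuts have small wide rank**: `#wide(s) ≤ r ⟹ WRankLE … s r` (take the wide forms themselves). -/
theorem wRankLE_of_card_le (hyl : ∀ g u, y g u = decide ((∑ i, if u i then lam g i else 0) = rr g))
    (s : ℕ) {r : ℕ} (h : (wideCuts lam s).card ≤ r) : WRankLE p y lam s r := by
  classical
  set W := wideCuts lam s with hW
  let e : W ≃ Fin W.card := W.equivFin
  refine ⟨W.card, h, fun k => lamW lam (e.symm k).1, fun g hg a b => ?_⟩
  have hgW : g ∈ W := by
    simpa only [hW, wideCuts, Finset.mem_filter, Finset.mem_univ, true_and] using hg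
  refine ⟨fun x => decide (x (e ⟨g, hgW⟩) = rhoW lam rr a b g), fun v => ?_⟩
  rw [linSel_glue3 y lam rr hyl g a v b]
  simp only [Equiv.symm_apply_apply]

/-- **The dense core has wide rank one**: if every wide cut's window form is a multiple of ONE form `β` (e.g. every
cut reads `|v| mod p`), then `WRankLE … s 1` — such windows are inside the span law (`(p + 2)·M ≤ ℓ`) although they
may have any number of wide cuts (outside the mixed law) and full rank `RankLE` (outside g24's rank law). -/
theorem wRankLE_one_of_colinear (hyl : ∀ g u, y g u = decide ((∑ i, if u i then lam g i else 0) = rr g))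
    (s : ℕ) (β : Fin ℓ → ZMod p) (hcol : ∀ g, s < (wsupp lam g).card → ∃ t : ZMod p, lamW lam g = t • β) :
    WRankLE p y lam s 1 := by
  refine ⟨1, le_rfl, fun _ => β, fun g hg a b => ?_⟩
  obtain ⟨t, ht⟩ := hcol g hg
  refine ⟨fun x => decide (t * x 0 = rhoW lam rr a b g), fun v => ?_⟩
  rw [linSel_glue3 y lam rr hyl g a v b]
  have hsum : (∑ j, if v j then lamW lam g j else 0) = t * ∑ j, if v j then β j else 0 := by
    rw [Finset.mul_sum]
    refine Finset.sum_congr rfl fun j _ => ?_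
    rw [ht, Pi.smul_apply, smul_eq_mul]
    split_ifs <;> simp
  rw [hsum]

/-- The sign of a fire function is `∓1` according to the selector bit. -/
theorem signChar_fireFn_eq_ite (a : Fin L → Bool) (b : Fin R → Bool) (g : Fin (L + ℓ + R + 1)) (v : Fin ℓ → Bool) :
    GowersCube.signChar (fireFn y a b g v) = if y g (glue3 a v b) = true then -1 else 1 := by
  unfold fireFn
  by_cases h : y g (glue3 a v b) = true
  · simp [h]
  · simp [h]

/-- **THE CLASS-SUM BOUND UNDER THE WIDE-RANK GRADE** (`p ≠ 3`): if the wide cuts answer through `≤ D` linear forms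
on the fibre, then for every class `r`, `‖Σ_v (−1)^{classPar_r(v)} ω^{|v|}‖ ≤ p^D · 2^ℓ · exp(−η_p ℓ/4^{s+1})`. -/
theorem norm_classSum_le_wrank (hp3 : p ≠ 3)
    (hyl : ∀ g u, y g u = decide ((∑ i, if u i then lam g i else 0) = rr g))
    (a : Fin L → Bool) (b : Fin R → Bool) (r : ℕ) {s D : ℕ} (hWR : WRankLE p y lam s D) :
    ‖∑ v : Fin ℓ → Bool, GowersCube.signChar (classPar c y a b r v) * omega3 ^ wt v‖ ≤
      (p : ℝ) ^ D * (2 ^ ℓ * Real.exp (-(etaP p * ℓ / 4 ^ (s + 1)))) := by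
  classical
  obtain ⟨d, hd, Φ, hΦ⟩ := hWR
  set Gr := univ.filter (fun g : Fin (L + ℓ + R + 1) => gapChar ℓ c a b g.val r % 3 ≠ 0) with hGr
  set Wr := Gr.filter (fun g => s < (wsupp lam g).card) with hWr
  set Nr := Gr.filter (fun g => ¬ s < (wsupp lam g).card) with hNr
  set Qn : CubeFn (ZMod 2) ℓ := ∑ g ∈ Nr, fireFn y a b g with hQn_def
  have hQn : Qn ∈ lowDeg (ZMod 2) ℓ s := Submodule.sum_mem _ fun g hg =>
    lowDeg_mono (not_lt.1 (Finset.mem_filter.1 hg).2) (fireFn_mem_lowDeg_wsupp y lam rr hyl g a b)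
  have hsplit : classPar c y a b r = (∑ g ∈ Wr, fireFn y a b g) + Qn := by
    rw [hQn_def, hWr, hNr, Finset.sum_filter_add_sum_filter_not, hGr]
    rfl
  -- the wide cuts answer through Φ on this fibre
  let Tg : Fin (L + ℓ + R + 1) → (Fin d → ZMod p) → Bool := fun g =>
    if hg : s < (wsupp lam g).card then Classical.choose (hΦ g hg a b) else fun _ => false
  have hTg : ∀ g ∈ Wr, ∀ v : Fin ℓ → Bool, y g (glue3 a v b) = Tg g (fun k => linPart (Φ k) v) := by
    intro g hg v
    have hgw : s < (wsupp lam g).card := (Finset.mem_filter.1 hg).2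
    show y g (glue3 a v b) = (if hg : s < (wsupp lam g).card then Classical.choose (hΦ g hg a b)
      else fun _ => false) (fun k => linPart (Φ k) v)
    rw [dif_pos hgw]
    exact Classical.choose_spec (hΦ g hgw a b) v
  let F : (Fin d → ZMod p) → ℂ := fun x => ∏ g ∈ Wr, (if Tg g x = true then (-1 : ℂ) else 1)
  have hF : ∀ x, ‖F x‖ ≤ 1 := by
    intro x
    show ‖∏ g ∈ Wr, (if Tg g x = true then (-1 : ℂ) else 1)‖ ≤ 1
    rw [norm_prod]
    refine le_of_eq (Finset.prod_eq_one fun g _ => ?_)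
    split_ifs <;> simp
  have hsgn : ∀ v, GowersCube.signChar (classPar c y a b r v) =
      GowersCube.signChar (Qn v) * F (fun k => linPart (Φ k) v) := by
    intro v
    rw [hsplit, Pi.add_apply, GowersCube.signChar_add, Finset.sum_apply, signChar_finset_sum, mul_comm]
    congr 1
    refine Finset.prod_congr rfl fun g hg => ?_
    rw [signChar_fireFn_eq_ite, hTg g hg v]
  have hT : ∀ μ : Fin ℓ → ZMod p,
      ‖∑ v, (GowersCube.signChar (Qn v) * omega3 ^ wt v) * ZMod.stdAddChar (linPart μ v)‖ ≤
        2 ^ ℓ * Real.exp (-(etaP p * ℓ / 4 ^ (s + 1))) :=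
    fun μ => norm_twisted_narrow_le hp3 hQn μ
  have h := norm_sum_mul_comp_le _ hT Φ F hF 0
  have h0 : ∀ v : Fin ℓ → Bool, (ZMod.stdAddChar (linPart (0 : Fin ℓ → ZMod p) v) : ℂ) = 1 := by
    intro v
    rw [show linPart (0 : Fin ℓ → ZMod p) v = 0 by simp [linPart], AddChar.map_zero_eq_one]
  simp_rw [h0, mul_one, Fintype.card_fin] at h
  have hp1 : (1 : ℝ) ≤ p := by exact_mod_cast (Fact.out : p.Prime).one_lt.le
  calc ‖∑ v, GowersCube.signChar (classPar c y a b r v) * omega3 ^ wt v‖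
      = ‖∑ v, GowersCube.signChar (Qn v) * omega3 ^ wt v * F (fun k => linPart (Φ k) v)‖ := by
        congr 1
        refine Finset.sum_congr rfl fun v _ => ?_
        rw [hsgn v]
        ring
    _ ≤ (p : ℝ) ^ d * (2 ^ ℓ * Real.exp (-(etaP p * ℓ / 4 ^ (s + 1)))) := h
    _ ≤ (p : ℝ) ^ D * (2 ^ ℓ * Real.exp (-(etaP p * ℓ / 4 ^ (s + 1)))) :=
        mul_le_mul_of_nonneg_right (pow_le_pow_right₀ hp1 hd) (by positivity)

omit [Fact p.Prime] in
/-- **Balance of the class-parity supports from a class-sum bound** (abstract form of §20):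
`‖classSum_r‖ ≤ X` for all `r` ⟹ `3·#{classPar_r ≠ 0, |v| ≡ r} ≤ #{classPar_r ≠ 0} + 1 + X`. -/
theorem three_mul_card_parClass_le_of_bound (a : Fin L → Bool) (b : Fin R → Bool) {X : ℝ}
    (hV : ∀ r : ℕ, ‖∑ v : Fin ℓ → Bool, GowersCube.signChar (classPar c y a b r v) * omega3 ^ wt v‖ ≤ X) (r : ℕ) :
    (3 : ℝ) * (univ.filter fun v : Fin ℓ → Bool => classPar c y a b r v ≠ 0 ∧ wt v % 3 = r % 3).card ≤
      (univ.filter fun v : Fin ℓ → Bool => classPar c y a b r v ≠ 0).card + (1 + X) := by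
  set B := univ.filter fun v : Fin ℓ → Bool => classPar c y a b r v ≠ 0 with hB
  have h1 := abs_three_mul_card_filter_mod_sub_card_le B r
  have hwt : ∀ v : Fin ℓ → Bool, Hegedus.wt v = wt v := fun v => rfl
  simp only [hwt] at h1
  have hBf : B.filter (fun v => wt v % 3 = r % 3) =
      univ.filter (fun v : Fin ℓ → Bool => classPar c y a b r v ≠ 0 ∧ wt v % 3 = r % 3) := by
    rw [hB, Finset.filter_filter]
  have hid : 2 * ∑ v ∈ B, omega3 ^ wt v = (∑ v : Fin ℓ → Bool, omega3 ^ wt v) -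
      ∑ v, GowersCube.signChar (classPar c y a b r v) * omega3 ^ wt v := by
    rw [hB, Finset.sum_filter, Finset.mul_sum, ← Finset.sum_sub_distrib]
    refine Finset.sum_congr rfl fun v _ => ?_
    by_cases hv : classPar c y a b r v = 0
    · simp [hv]
    · simp [hv, GowersCube.signChar]
      ring
  have hT1 : ‖∑ v : Fin ℓ → Bool, omega3 ^ wt v‖ = 1 := norm_sum_omega3_pow_wt ℓ
  have hnorm : 2 * ‖∑ v ∈ B, omega3 ^ wt v‖ ≤ 1 + X := by
    calc 2 * ‖∑ v ∈ B, omega3 ^ wt v‖ = ‖2 * ∑ v ∈ B, omega3 ^ wt v‖ := by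
          rw [norm_mul, Complex.norm_ofNat]
      _ = ‖(∑ v : Fin ℓ → Bool, omega3 ^ wt v) -
            ∑ v, GowersCube.signChar (classPar c y a b r v) * omega3 ^ wt v‖ := by rw [hid]
      _ ≤ ‖∑ v : Fin ℓ → Bool, omega3 ^ wt v‖ +
            ‖∑ v, GowersCube.signChar (classPar c y a b r v) * omega3 ^ wt v‖ := norm_sub_le _ _
      _ ≤ 1 + X := by rw [hT1]; linarith [hV r]
  have h2 := (abs_le.1 h1).2
  rw [hBf] at h2
  linarith

omit [Fact p.Prime] in
/-- **Fibre theorem from a class-sum bound** (abstract form of §20; cut structure used: two-liveness):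
`‖classSum_r‖ ≤ X` for all `r` on a cut-free window ⟹ `3·#WIN ≤ 2·2^ℓ + 3·(1 + X)` on the fibre. -/
theorem three_mul_win_fibre_le_of_bound (hgap : CutFree y L ℓ) (a : Fin L → Bool) (b : Fin R → Bool) {X : ℝ}
    (hV : ∀ r : ℕ, ‖∑ v : Fin ℓ → Bool, GowersCube.signChar (classPar c y a b r v) * omega3 ^ wt v‖ ≤ X) :
    (3 : ℝ) * (univ.filter fun v : Fin ℓ → Bool => ringWinU c y (glue3 a v b) = true).card ≤
      2 * 2 ^ ℓ + 3 * (1 + X) := by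
  set E := (1 + X) with hE
  rw [card_win_fibre_eq c y hgap a b]
  push_cast
  rw [Finset.mul_sum]
  have hclass : ∀ r ∈ range 3,
      (3 : ℝ) * ((univ.filter fun v : Fin ℓ → Bool => wt v % 3 = r ∧ fireCount c y a b r v % 2 = 1).card : ℝ) ≤
        ((univ.filter fun v : Fin ℓ → Bool => fireCount c y a b r v % 2 = 1).card : ℝ) + E := by
    intro r hr
    have hr3 : r % 3 = r := Nat.mod_eq_of_lt (Finset.mem_range.1 hr)
    have h := three_mul_card_parClass_le_of_bound c y a b hV r
    have e1 : (univ.filter fun v : Fin ℓ → Bool => classPar c y a b r v ≠ 0 ∧ wt v % 3 = r % 3) =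
        univ.filter fun v : Fin ℓ → Bool => wt v % 3 = r ∧ fireCount c y a b r v % 2 = 1 := by
      refine Finset.filter_congr fun v _ => ?_
      rw [classPar_ne_zero_iff, hr3]
      exact and_comm
    have e2 : (univ.filter fun v : Fin ℓ → Bool => classPar c y a b r v ≠ 0) =
        univ.filter fun v : Fin ℓ → Bool => fireCount c y a b r v % 2 = 1 :=
      Finset.filter_congr fun v _ => classPar_ne_zero_iff c y a b r v
    rw [e1, e2] at h
    exact h
  have hsum : (∑ r ∈ range 3, ((univ.filter fun v : Fin ℓ → Bool => fireCount c y a b r v % 2 = 1).card : ℝ)) ≤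
      2 * 2 ^ ℓ := by
    have h := sum_three_classes_le c y a b
    have h' : ((∑ r ∈ range 3, (univ.filter fun v : Fin ℓ → Bool => fireCount c y a b r v % 2 = 1).card : ℕ) : ℝ)
        ≤ ((2 * 2 ^ ℓ : ℕ) : ℝ) := by exact_mod_cast h
    push_cast at h'
    exact h'
  calc ∑ r ∈ range 3, (3 : ℝ) * ((univ.filter fun v : Fin ℓ → Bool =>
          wt v % 3 = r ∧ fireCount c y a b r v % 2 = 1).card : ℝ)
      ≤ ∑ r ∈ range 3, (((univ.filter fun v : Fin ℓ → Bool => fireCount c y a b r v % 2 = 1).card : ℝ) + E) :=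
        Finset.sum_le_sum hclass
    _ = (∑ r ∈ range 3, ((univ.filter fun v : Fin ℓ → Bool => fireCount c y a b r v % 2 = 1).card : ℝ)) + 3 * E := by
        rw [Finset.sum_add_distrib, Finset.sum_const, Finset.card_range]
        simp
    _ ≤ 2 * 2 ^ ℓ + 3 * E := by linarith

omit [Fact p.Prime] in
/-- `p^D ≤ 3^{p·D}` (crude: `p ≤ 3^p`), so the span error fits the mixed absorption lemma with `k = p·D`. -/
theorem pow_le_three_pow_mul (D : ℕ) : (p : ℝ) ^ D ≤ 3 ^ (p * D) := by
  have h3 : p ≤ 3 ^ p := (Nat.lt_pow_self (by norm_num : 1 < 3)).le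
  have h3' : (p : ℝ) ≤ (3 : ℝ) ^ p := by exact_mod_cast h3
  calc (p : ℝ) ^ D ≤ ((3 : ℝ) ^ p) ^ D := pow_le_pow_left₀ (Nat.cast_nonneg p) h3' D
    _ = 3 ^ (p * D) := by rw [← pow_mul]

/-- **SPAN FIBRE THEOREM, absorbed** (`p ≠ 3`): `2·4^{s+1} ≤ M·η_p`, wide rank `≤ D` on the fibres and
`(p·D + 2)·M ≤ ℓ` ⟹ `12·#WIN ≤ 11·2^ℓ` on every outside fibre. -/
theorem twelve_mul_win_fibre_le_wrank (hp3 : p ≠ 3)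
    (hyl : ∀ g u, y g u = decide ((∑ i, if u i then lam g i else 0) = rr g)) (hgap : CutFree y L ℓ)
    {s M D : ℕ} (hM : 2 * 4 ^ (s + 1) ≤ (M : ℝ) * etaP p) (hWR : WRankLE p y lam s D)
    (hℓ : (p * D + 2) * M ≤ ℓ) (a : Fin L → Bool) (b : Fin R → Bool) :
    12 * (univ.filter fun v : Fin ℓ → Bool => ringWinU c y (glue3 a v b) = true).card ≤ 11 * 2 ^ ℓ := by
  have hX : ∀ r : ℕ, ‖∑ v : Fin ℓ → Bool, GowersCube.signChar (classPar c y a b r v) * omega3 ^ wt v‖ ≤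
      3 ^ (p * D) * (2 ^ ℓ * Real.exp (-(etaP p * ℓ / 4 ^ (s + 1)))) := fun r =>
    le_trans (norm_classSum_le_wrank c y lam rr hp3 hyl a b r hWR)
      (mul_le_mul_of_nonneg_right (pow_le_three_pow_mul (p := p) D) (by positivity))
  have h3 := three_mul_win_fibre_le_of_bound c y hgap a b hX
  have hE := mixed_err_absorb (etaP_pos (p := p)) (etaP_le_two p) hM hℓ
  have h : (12 : ℝ) * ((univ.filter fun v : Fin ℓ → Bool => ringWinU c y (glue3 a v b) = true).card : ℝ) ≤
      11 * (2 : ℝ) ^ ℓ := by linarith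
  exact_mod_cast h

end SpanFibre

/-- **SPAN WINDOW THEOREM** (Fubini over the outside fibres): `12·#WIN ≤ 11·2ⁿ`. -/
theorem window_bound_wrank {p : ℕ} [Fact p.Prime] (hp3 : p ≠ 3) (L ℓ R : ℕ) (c : ℕ)
    (y : Fin (L + ℓ + R + 1) → (Fin (L + ℓ + R) → Bool) → Bool)
    (lam : Fin (L + ℓ + R + 1) → Fin (L + ℓ + R) → ZMod p) (rr : Fin (L + ℓ + R + 1) → ZMod p)
    (hyl : ∀ g u, y g u = decide ((∑ i, if u i then lam g i else 0) = rr g)) (hgap : CutFree y L ℓ)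
    {s M D : ℕ} (hM : 2 * 4 ^ (s + 1) ≤ (M : ℝ) * etaP p) (hWR : WRankLE p y lam s D)
    (hℓ : (p * D + 2) * M ≤ ℓ) :
    12 * (univ.filter fun u : Fin (L + ℓ + R) → Bool => ringWinU c y u = true).card ≤ 11 * 2 ^ (L + ℓ + R) := by
  rw [card_filter_eq_sum_glue3 (fun w => ringWinU c y w = true), Finset.mul_sum]
  calc ∑ a : Fin L → Bool, 12 * ∑ b : Fin R → Bool,
        (univ.filter fun v : Fin ℓ → Bool => ringWinU c y (glue3 a v b) = true).card
      ≤ ∑ _a : Fin L → Bool, 2 ^ R * (11 * 2 ^ ℓ) := by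
        refine Finset.sum_le_sum fun a _ => ?_
        rw [Finset.mul_sum]
        calc ∑ b : Fin R → Bool, 12 * (univ.filter fun v : Fin ℓ → Bool => ringWinU c y (glue3 a v b) = true).card
            ≤ ∑ _b : Fin R → Bool, 11 * 2 ^ ℓ :=
              Finset.sum_le_sum fun b _ => twelve_mul_win_fibre_le_wrank c y lam rr hp3 hyl hgap hM hWR hℓ a b
          _ = 2 ^ R * (11 * 2 ^ ℓ) := by
            rw [Finset.sum_const, Finset.card_univ, Fintype.card_fun, Fintype.card_bool, Fintype.card_fin,
              smul_eq_mul]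
    _ = 2 ^ L * (2 ^ R * (11 * 2 ^ ℓ)) := by
        rw [Finset.sum_const, Finset.card_univ, Fintype.card_fun, Fintype.card_bool, Fintype.card_fin,
          smul_eq_mul]
    _ = 11 * 2 ^ (L + ℓ + R) := by rw [pow_add, pow_add]; ring

end Summit.QuantumAdvantage.QuantumAdvantage.Theorems.RankDial

end
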